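import Literature.Topology.FourManifolds.SimplifiedBrokenLefschetzRoundSlicesIndex
import Literature.Topology.FourManifolds.RegularFibreMorsePerturbation
import Mathlib.Analysis.Calculus.BumpFunction.InnerProduct
import HarnessLib

/-!
# Base chart, cutoff, `ε`, round points — helpers `helper_sixCrit_hemisphere`,
`helper_sixCrit_annulus`, `helper_sixCrit_cutoff`, `helper_sixCrit_offRange` of stub
`stub_sixCrit` (line `Sketch`, crux `SblfDescent.RungOne`)

(Crux item stmt-SmoothPoincare4-18531; skeleton `Cruxes/RungOne/Lines/Sketch.lean`.)

The planar and base-sphere ingredients of the six-point Morse function of `stub_sixCrit`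
(Milnor 1963, §2–§3):

* **`helper_sixCrit_hemisphere`** — the hemisphere chart `κ_v = (univBall 0 2)⁻¹ ∘ σ_v` of the
  open hemisphere `{⟪·, v⟫ < 0}` onto `ℝ²` (inverse `ψ_v = σ_v⁻¹ ∘ univBall 0 2`) is a smooth
  chart of `S²`, so criticality, nondegeneracy and Morse index of `ℓ` at `ψ_v w` are those of
  `ℓ ∘ ψ_v` at `w` (`morseData_of_localRepresentative`);
* **`helper_sixCrit_annulus`** — if `Dλ` vanishes only at `w_m`, `w_M`, then for `ε > 0` small
  `Dλ_w + ε t Dρ_w ≠ 0` on the annuli `r/2 ≤ dist ≤ r` about `w_m`, `w_M`, `|t| ≤ 1`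
  (compactness: `‖Dλ‖ ≥ c > 0` and `‖Dρ‖ ≤ C` there);
* **`helper_sixCrit_cutoff`** — a smooth plateau cutoff on `ℝ²`, `≡ 1` on the `r/2`-balls about
  `w_m`, `w_M`, `≡ 0` off the `r`-balls, `|ρ| ≤ 1` (sum of two Mathlib `ContDiffBump`s);
* **`helper_sixCrit_offRange`** — for a genus-one Lefschetz-free SBLF with equatorial round image
  and pole `v = (0, 0, ±1)`: the two round points `q₋`, `q₊` over `(∓1, 0, 0)` exist, and a
  function with the germ of `ℓ ∘ f` at a point `x` off the sphere side `{⟪f ·, v⟫ < 0}` is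
  critical at `x` iff `x ∈ {q₋, q₊}`, nondegenerate there with the index of `ℓ ∘ f`
  (germ invariance of the Morse data; regular points of `f` are regular for `ℓ ∘ f` since the
  critical points of `ℓ` lie on the sphere side).

References: J. Milnor, *Morse theory* (1963), §2–§3 [Milnor1963]; K. Hayano, *On genus-1
simplified broken Lefschetz fibrations*, AGT 11 (2011), Def. 2.1 [Hayano2011].
-/

set_option linter.dupNamespace false

noncomputable section

open scoped Manifold ContDiff Topology RealInnerProductSpace
open Set Function Literature.Topology.FourManifolds Literature.AlgebraicTopology.SingularHomology

namespace Summit.SmoothPoincare4.SmoothPoincare4.Cruxes.RungOne.Sketch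

/-- Local notation: `𝔼 n` is the model Euclidean space `EuclideanSpace ℝ (Fin n)`. -/
local notation "𝔼 " n:arg => EuclideanSpace ℝ (Fin n)

/-- Local notation: `𝕊²`, the unit sphere of `ℝ³`. -/
local notation "𝕊²" => (Metric.sphere (0 : EuclideanSpace ℝ (Fin 3)) (1 : ℝ))

attribute [local instance] Literature.Topology.FourManifolds.fact_finrank_euclideanSpace_succ

/-! ### The hemisphere chart -/

/-- **Registered helper `helper_sixCrit_hemisphere`.**  With `ψ = σ_v⁻¹ ∘ univBall 0 2 : ℝ² → S²`
(a diffeomorphism onto the open hemisphere opposite `v`, inverse `κ = (univBall 0 2)⁻¹ ∘ σ_v`,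
an open partial homeomorphism `C^∞` with `C^∞` inverse by the tree's
`SimplifiedBrokenLefschetzSides` lemmas): `ψ w` is critical for `ℓ` iff `D(ℓ ∘ ψ)_w = 0`, and then
the Hessians are simultaneously nondegenerate and the Morse indices agree (Milnor 1963, §2:
independence of the coordinate system). [cite: Milnor1963, §2] -/
theorem helper_sixCrit_hemisphere :
    ∀ (v : 𝕊²) (ℓ : 𝕊² → ℝ), ContMDiff (𝓡 2) 𝓘(ℝ, ℝ) ∞ ℓ → ∀ (ψ : 𝔼 2 → 𝕊²),
      ψ = (fun w : 𝔼 2 => (stereographic' 2 v).symm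
        (OpenPartialHomeomorph.univBall (0 : 𝔼 2) 2 w)) → ∀ w : 𝔼 2,
      (IsMCriticalPt (𝓡 2) ℓ (ψ w) ↔ fderiv ℝ (ℓ ∘ ψ) w = 0) ∧
      (IsMCriticalPt (𝓡 2) ℓ (ψ w) →
        ((mhessian (𝓡 2) ℓ (ψ w)).Nondegenerate ↔ (mhessian (𝓡 2) (ℓ ∘ ψ) w).Nondegenerate) ∧
        morseIndex (𝓡 2) ℓ (ψ w) = morseIndex (𝓡 2) (ℓ ∘ ψ) w) := by
  intro v ℓ hℓ ψ hψ w
  -- the hemisphere chart as an open partial homeomorphism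
  obtain ⟨Θ, hΘ, hΘs, hsrc⟩ : ∃ Θ : OpenPartialHomeomorph 𝕊² (𝔼 2),
      (∀ y, Θ y = (OpenPartialHomeomorph.univBall (0 : 𝔼 2) 2).symm (stereographic' 2 v y)) ∧
      (∀ u, Θ.symm u = ψ u) ∧ Θ.source = {y : 𝕊² | ⟪(y : 𝔼 3), (v : 𝔼 3)⟫ < 0} :=
    ⟨{ toFun := fun y => (OpenPartialHomeomorph.univBall (0 : 𝔼 2) 2).symm (stereographic' 2 v y)
       invFun := ψ
       source := {y : 𝕊² | ⟪(y : 𝔼 3), (v : 𝔼 3)⟫ < 0}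
       target := univ
       map_source' := fun _ _ => mem_univ _
       map_target' := fun u _ => by
         rw [hψ]; exact inner_stereographic'_symm_univBall_lt_zero v u
       left_inv' := fun _ hy => by
         rw [hψ]; exact stereographic'_symm_univBall_univBall_symm_stereographic' hy
       right_inv' := fun u _ => by
         rw [hψ]; exact univBall_symm_stereographic'_stereographic'_symm_univBall v u
       open_source := isOpen_setOf_inner_lt_zero v
       open_target := isOpen_univ
       continuousOn_toFun := (contMDiffOn_univBall_symm_stereographic' v).continuousOn
       continuousOn_invFun :=
         (hψ ▸ contMDiff_stereographic'_symm_univBall v).continuous.continuousOn },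
      fun _ => rfl, fun _ => rfl, rfl⟩
  have hψs : ContMDiff 𝓘(ℝ, 𝔼 2) (𝓡 2) ∞ ψ := hψ ▸ contMDiff_stereographic'_symm_univBall v
  have hΘsm : ContMDiffOn (𝓡 2) (𝓡 2) ∞ Θ Θ.source := by
    rw [hsrc]; exact (contMDiffOn_univBall_symm_stereographic' v).congr fun y _ => hΘ y
  have hΘsm' : ContMDiffOn (𝓡 2) (𝓡 2) ∞ Θ.symm Θ.target :=
    hψs.contMDiffOn.congr fun u _ => hΘs u
  have hq : ψ w ∈ Θ.source := by
    rw [hsrc, hψ]; exact inner_stereographic'_symm_univBall_lt_zero v w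
  have hΘq : Θ (ψ w) = w := by
    rw [hΘ, hψ]; exact univBall_symm_stereographic'_stereographic'_symm_univBall v w
  have hlam : ContDiff ℝ ∞ (ℓ ∘ ψ) := contMDiff_iff_contDiff.1 (hℓ.comp hψs)
  have hG : ContDiffAt ℝ 2 (ℓ ∘ ψ) (Θ (ψ w)) := (hlam.of_le (by norm_cast)).contDiffAt
  have hfG : ℓ ∘ Θ.symm =ᶠ[𝓝 (Θ (ψ w))] ℓ ∘ ψ :=
    Filter.Eventually.of_forall fun u => by simp only [Function.comp_apply, hΘs]
  have key := morseData_of_localRepresentative (n := 1) hΘsm hΘsm' hq hG hfG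
  rwa [hΘq] at key

/-! ### No critical points in the cutoff annuli for `ε` small -/

/-- **Registered helper `helper_sixCrit_annulus`.**  If `λ, ρ : ℝ² → ℝ` are `C^∞` and `Dλ`
vanishes only at `w_m`, `w_M`, then for every `δ > 0` there is `0 < ε < δ` with
`Dλ_w + ε t Dρ_w ≠ 0` whenever `r/2 ≤ dist w w_m`, `r/2 ≤ dist w w_M`, one of them `≤ r`, and
`|t| ≤ 1`: on this compact set `‖Dλ‖ ≥ c > 0` and `‖Dρ‖ ≤ C`, take `ε C < c` (Milnor 1963, §2:
the perturbation creates no critical points where `d(ℓ ∘ f) ≠ 0`). [cite: Milnor1963, §2] -/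
theorem helper_sixCrit_annulus :
    ∀ (lam ρ : 𝔼 2 → ℝ) (wm wM : 𝔼 2) (r δ : ℝ), ContDiff ℝ ∞ lam → ContDiff ℝ ∞ ρ →
      0 < r → 0 < δ → (∀ w, fderiv ℝ lam w = 0 → w = wm ∨ w = wM) →
      ∃ ε : ℝ, 0 < ε ∧ ε < δ ∧ ∀ w : 𝔼 2, r / 2 ≤ dist w wm → r / 2 ≤ dist w wM →
        (dist w wm ≤ r ∨ dist w wM ≤ r) → ∀ t : ℝ, |t| ≤ 1 →
          fderiv ℝ lam w + (ε * t) • fderiv ℝ ρ w ≠ 0 := by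
  intro lam ρ wm wM r δ hlam hρ hr hδ hcrit
  set A : Set (𝔼 2) := {w | r / 2 ≤ dist w wm ∧ r / 2 ≤ dist w wM ∧
    (dist w wm ≤ r ∨ dist w wM ≤ r)} with hA
  have hAsub : A ⊆ Metric.closedBall wm r ∪ Metric.closedBall wM r := by
    rintro w ⟨-, -, hw | hw⟩
    · exact Or.inl (Metric.mem_closedBall.2 hw)
    · exact Or.inr (Metric.mem_closedBall.2 hw)
  have hAclosed : IsClosed A := by
    have h1 : Continuous fun w : 𝔼 2 => dist w wm := continuous_id.dist continuous_const
    have h2 : Continuous fun w : 𝔼 2 => dist w wM := continuous_id.dist continuous_const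
    exact (isClosed_le continuous_const h1).inter ((isClosed_le continuous_const h2).inter
      ((isClosed_le h1 continuous_const).union (isClosed_le h2 continuous_const)))
  have hAc : IsCompact A :=
    ((isCompact_closedBall wm r).union (isCompact_closedBall wM r)).of_isClosed_subset
      hAclosed hAsub
  -- `Dλ ≠ 0` on `A`, so `‖Dλ‖ ≥ c > 0` there
  have hne : ∀ w ∈ A, fderiv ℝ lam w ≠ 0 := by
    rintro w ⟨h1, h2, -⟩ h0
    rcases hcrit w h0 with rfl | rfl
    · rw [dist_self] at h1; linarith
    · rw [dist_self] at h2; linarith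
  have hcontlam : ContinuousOn (fun w => ‖fderiv ℝ lam w‖) A :=
    (hlam.continuous_fderiv (by simp)).norm.continuousOn
  obtain ⟨c, hc, hcle⟩ : ∃ c, 0 < c ∧ ∀ w ∈ A, c ≤ ‖fderiv ℝ lam w‖ := by
    rcases A.eq_empty_or_nonempty with hAe | hAne
    · exact ⟨1, one_pos, fun w hw => by rw [hAe] at hw; exact absurd hw (notMem_empty w)⟩
    · obtain ⟨w₀, hw₀, hmin⟩ := hAc.exists_isMinOn hAne hcontlam
      exact ⟨‖fderiv ℝ lam w₀‖, norm_pos_iff.2 (hne w₀ hw₀), fun w hw => hmin hw⟩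
  -- `‖Dρ‖ ≤ C` on `A`
  obtain ⟨C, hC⟩ :=
    hAc.exists_bound_of_continuousOn (hρ.continuous_fderiv (by simp)).continuousOn
  set Cp : ℝ := |C| + 1 with hCp
  have hCppos : 0 < Cp := by positivity
  have hCle : ∀ w ∈ A, ‖fderiv ℝ ρ w‖ ≤ Cp := fun w hw =>
    (hC w hw).trans ((le_abs_self C).trans (by linarith))
  refine ⟨min (δ / 2) (c / (2 * Cp)), lt_min (by positivity) (by positivity),
    (min_le_left _ _).trans_lt (by linarith), fun w h1 h2 h3 t ht h0 => ?_⟩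
  set ε := min (δ / 2) (c / (2 * Cp)) with hε
  have hεpos : 0 < ε := lt_min (by positivity) (by positivity)
  have hwA : w ∈ A := ⟨h1, h2, h3⟩
  have hεC : ε * Cp ≤ c / 2 := by
    have : ε ≤ c / (2 * Cp) := min_le_right _ _
    calc ε * Cp ≤ c / (2 * Cp) * Cp := by gcongr
      _ = c / 2 := by field_simp
  have heq : fderiv ℝ lam w = -((ε * t) • fderiv ℝ ρ w) := eq_neg_of_add_eq_zero_left h0
  have hnorm : ‖fderiv ℝ lam w‖ ≤ c / 2 := by
    rw [heq, norm_neg, norm_smul, norm_mul, Real.norm_eq_abs, Real.norm_eq_abs, abs_of_pos hεpos]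
    calc ε * |t| * ‖fderiv ℝ ρ w‖ ≤ ε * 1 * Cp := by
          gcongr
          exact hCle w hwA
      _ = ε * Cp := by ring
      _ ≤ c / 2 := hεC
  have := hcle w hwA
  linarith

/-! ### The plateau cutoff -/

/-- **Registered helper `helper_sixCrit_cutoff`.**  For `0 < r`, `2r < dist w_m w_M` there is
a `C^∞` function `ρ : ℝ² → ℝ` with `ρ = 1` where `dist w w_m ≤ r/2` or `dist w w_M ≤ r/2`,
`ρ = 0` where `dist w w_m ≥ r` and `dist w w_M ≥ r`, and `|ρ| ≤ 1`: the sum of two bump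
functions (Mathlib's `ContDiffBump`, radii `r/2 < r`) with disjoint supports. [folklore] -/
theorem helper_sixCrit_cutoff :
    ∀ (wm wM : 𝔼 2) (r : ℝ), 0 < r → 2 * r < dist wm wM →
      ∃ ρ : 𝔼 2 → ℝ, ContDiff ℝ ∞ ρ ∧
        (∀ w, dist w wm ≤ r / 2 ∨ dist w wM ≤ r / 2 → ρ w = 1) ∧
        (∀ w, r ≤ dist w wm → r ≤ dist w wM → ρ w = 0) ∧ (∀ w, |ρ w| ≤ 1) := by
  intro wm wM r hr hd
  set b₁ : ContDiffBump wm := ⟨r / 2, r, by positivity, by linarith⟩ with hb₁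
  set b₂ : ContDiffBump wM := ⟨r / 2, r, by positivity, by linarith⟩ with hb₂
  have h1 : ∀ w, dist w wm ≤ r / 2 → b₁ w = 1 := fun w hw =>
    b₁.one_of_mem_closedBall (by simpa [hb₁] using hw)
  have h2 : ∀ w, dist w wM ≤ r / 2 → b₂ w = 1 := fun w hw =>
    b₂.one_of_mem_closedBall (by simpa [hb₂] using hw)
  have h1' : ∀ w, r ≤ dist w wm → b₁ w = 0 := fun w hw => b₁.zero_of_le_dist hw
  have h2' : ∀ w, r ≤ dist w wM → b₂ w = 0 := fun w hw => b₂.zero_of_le_dist hw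
  -- the two `r`-balls are disjoint
  have hfar₁ : ∀ w, dist w wm < r → r ≤ dist w wM := fun w hw => by
    have := dist_triangle wm w wM
    rw [dist_comm wm w] at this
    linarith
  have hfar₂ : ∀ w, dist w wM < r → r ≤ dist w wm := fun w hw => by
    have := dist_triangle wM w wm
    rw [dist_comm wM w, dist_comm wM wm] at this
    linarith
  refine ⟨fun w => b₁ w + b₂ w, b₁.contDiff.add b₂.contDiff, fun w hw => ?_, fun w hm hM => ?_,
    fun w => ?_⟩
  · show b₁ w + b₂ w = 1
    rcases hw with hw | hw
    · rw [h1 w hw, h2' w (hfar₁ w (by linarith)), add_zero]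
    · rw [h2 w hw, h1' w (hfar₂ w (by linarith)), zero_add]
  · show b₁ w + b₂ w = 0
    rw [h1' w hm, h2' w hM, add_zero]
  · show |b₁ w + b₂ w| ≤ 1
    rcases lt_or_ge (dist w wm) r with hw | hw
    · rw [h2' w (hfar₁ w hw), add_zero, abs_of_nonneg b₁.nonneg]
      exact b₁.le_one
    · rw [h1' w hw, zero_add, abs_of_nonneg b₂.nonneg]
      exact b₂.le_one

/-! ### The base function, the round points, and the critical points off the sphere side -/

/-- The base function `ℓ(y) = y₀ (1 - ¼⟪y, v⟫)` is smooth on `S²` (a polynomial in the ambient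
coordinates restricted to the sphere). [folklore] -/
theorem contMDiff_baseFn (v : 𝕊²) :
    ContMDiff (𝓡 2) 𝓘(ℝ, ℝ) ∞
      (fun y : 𝕊² => (y : 𝔼 3) 0 * (1 + (-(1 / 4 : ℝ)) * ⟪(y : 𝔼 3), (v : 𝔼 3)⟫)) := by
  have h0 : ContMDiff (𝓡 2) 𝓘(ℝ, ℝ) ∞ fun y : 𝕊² => (y : 𝔼 3) 0 :=
    (EuclideanSpace.proj (0 : Fin 3)).contDiff.comp_contMDiff contMDiff_coe_sphere
  have h1 : ContMDiff (𝓡 2) 𝓘(ℝ, ℝ) ∞ fun y : 𝕊² => ⟪(y : 𝔼 3), (v : 𝔼 3)⟫ :=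
    (contDiff_id.inner ℝ contDiff_const).comp_contMDiff contMDiff_coe_sphere
  exact h0.mul (contMDiff_const.add (contMDiff_const.mul h1))

section Round

variable {X : Type*} [TopologicalSpace X] [ChartedSpace (𝔼 4) X] [IsManifold (𝓡 4) ∞ X]
  {o : SmoothOrientation (𝓡 4) X} {f : X → 𝕊²}

/-- **A round point over `(s, 0, 0)`, `s = ±1`**: the round image is the equator
(`sphereEquator 1 = {y₂ = 0}`), which contains `(±1, 0, 0)`. [cite: Hayano2011, Def. 2.1] -/
theorem exists_round_over_axis (hf : IsSimplifiedBrokenLefschetzFibration o f ∅ 0)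
    (hC : f '' ({p : X | ¬ Surjective (mfderiv (𝓡 4) (𝓡 2) f p)} \ (↑(∅ : Finset X) : Set X)) =
      sphereEquator 1) {s : ℝ} (hs : s = 1 ∨ s = -1) :
    ∃ q, ¬ Surjective (mfderiv (𝓡 4) (𝓡 2) f q) ∧ ((f q : 𝕊²) : 𝔼 3) 0 = s ∧
      ((f q : 𝕊²) : 𝔼 3) 1 = 0 ∧ ((f q : 𝕊²) : 𝔼 3) 2 = 0 := by
  have _ := hf.contMDiff
  have hys : EuclideanSpace.single (0 : Fin 3) s ∈ Metric.sphere (0 : 𝔼 3) 1 := by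
    rw [mem_sphere_zero_iff_norm, EuclideanSpace.norm_eq]
    rcases hs with rfl | rfl <;> simp
  set y : 𝕊² := ⟨EuclideanSpace.single (0 : Fin 3) s, hys⟩ with hy
  have hyeq : y ∈ sphereEquator 1 := (mem_sphereEquator_iff y).2 (by simp [hy])
  rw [← hC] at hyeq
  obtain ⟨q, ⟨hq, -⟩, hfq⟩ := hyeq
  refine ⟨q, hq, ?_, ?_, ?_⟩ <;> simp [hfq, hy]

end Round

/-- **Registered helper `helper_sixCrit_offRange`.**  For a genus-one Lefschetz-free SBLF `f`
on a closed `X` with equatorial round image, a pole `v = (0, 0, ±1)`, the base function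
`ℓ(y) = y₀ (1 - ¼⟪y, v⟫)` all of whose critical points lie on the sphere side `{⟪·, v⟫ < 0}`,
and the round-point Morse data of `ℓ ∘ f` (critical iff `(f q)₁ = 0`, then nondegenerate of
index `3` or `1`): the two round points `q₋ ≠ q₊` over `(∓1, 0, 0)` exist (values
`ℓ (f q∓) = ∓1`, not on the sphere side), and every `G` with the germ of `ℓ ∘ f` at a point `x`
off the sphere side is critical at `x` iff `x ∈ {q₋, q₊}`, nondegenerate there of index `3`
over `(1,0,0)`, `1` over `(-1,0,0)` — at regular points of `f`, `d(ℓ ∘ f) = dℓ ∘ df` with `df`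
onto (Milnor 1963, §2), at round points `f` is injective on the critical set (Hayano 2011,
Def. 2.1 (5)), and the Morse data depend only on the germ. [cite: Milnor1963, §2]
[cite: Hayano2011, Def. 2.1] -/
theorem helper_sixCrit_offRange :
    ∀ (X : Type) [TopologicalSpace X] [T2Space X] [SecondCountableTopology X] [CompactSpace X]
      [ChartedSpace (𝔼 4) X] [IsManifold (𝓡 4) ∞ X]
      (o : SmoothOrientation (𝓡 4) X) (f : X → 𝕊²),
      IsSimplifiedBrokenLefschetzFibration o f ∅ 0 →
      f '' ({p : X | ¬ Surjective (mfderiv (𝓡 4) (𝓡 2) f p)} \ (↑(∅ : Finset X) : Set X)) =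
        sphereEquator 1 →
      ∀ (v : 𝕊²), (v : 𝔼 3) 0 = 0 → (v : 𝔼 3) 1 = 0 →
      ∀ ℓ : 𝕊² → ℝ, ℓ = (fun y : 𝕊² => (y : 𝔼 3) 0 * (1 + (-(1 / 4 : ℝ)) * ⟪(y : 𝔼 3), (v : 𝔼 3)⟫)) →
      (∀ y : 𝕊², IsMCriticalPt (𝓡 2) ℓ y → ⟪(y : 𝔼 3), (v : 𝔼 3)⟫ < 0) →
      (∀ q : X, ¬ Surjective (mfderiv (𝓡 4) (𝓡 2) f q) →
        (IsMCriticalPt (𝓡 4) (ℓ ∘ f) q ↔ ((f q : 𝕊²) : 𝔼 3) 1 = 0) ∧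
        (((f q : 𝕊²) : 𝔼 3) 1 = 0 → (mhessian (𝓡 4) (ℓ ∘ f) q).Nondegenerate ∧
          morseIndex (𝓡 4) (ℓ ∘ f) q = if 0 < ((f q : 𝕊²) : 𝔼 3) 0 then 3 else 1)) →
      ∃ qm qM : X, qm ≠ qM ∧
        ¬ Surjective (mfderiv (𝓡 4) (𝓡 2) f qm) ∧ ¬ Surjective (mfderiv (𝓡 4) (𝓡 2) f qM) ∧
        ((f qm : 𝕊²) : 𝔼 3) 0 = -1 ∧ ((f qM : 𝕊²) : 𝔼 3) 0 = 1 ∧ ℓ (f qm) = -1 ∧ ℓ (f qM) = 1 ∧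
        ¬ ⟪((f qm : 𝕊²) : 𝔼 3), (v : 𝔼 3)⟫ < 0 ∧ ¬ ⟪((f qM : 𝕊²) : 𝔼 3), (v : 𝔼 3)⟫ < 0 ∧
        ∀ (G : X → ℝ) (x : X), ¬ ⟪((f x : 𝕊²) : 𝔼 3), (v : 𝔼 3)⟫ < 0 → G =ᶠ[𝓝 x] ℓ ∘ f →
          (IsMCriticalPt (𝓡 4) G x ↔ (x = qm ∨ x = qM)) ∧
          (IsMCriticalPt (𝓡 4) G x → (mhessian (𝓡 4) G x).Nondegenerate ∧
            morseIndex (𝓡 4) G x = if 0 < ((f x : 𝕊²) : 𝔼 3) 0 then 3 else 1) := by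
  intro X _ _ _ _ _ _ o f hf hC v hv0 hv1 ℓ hℓ hcritv hround
  obtain ⟨qm, hqm, hqm0, hqm1, hqm2⟩ := exists_round_over_axis hf hC (s := -1) (Or.inr rfl)
  obtain ⟨qM, hqM, hqM0, hqM1, hqM2⟩ := exists_round_over_axis hf hC (s := 1) (Or.inl rfl)
  have hℓs : ContMDiff (𝓡 2) 𝓘(ℝ, ℝ) ∞ ℓ := hℓ ▸ contMDiff_baseFn v
  have hinner : ∀ q, ((f q : 𝕊²) : 𝔼 3) 2 = 0 → ⟪((f q : 𝕊²) : 𝔼 3), (v : 𝔼 3)⟫ = 0 :=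
    fun q hq => by rw [BandFoliation.inner_eq_three, hv0, hv1, hq]; ring
  have hℓq : ∀ q, ((f q : 𝕊²) : 𝔼 3) 2 = 0 → ℓ (f q) = ((f q : 𝕊²) : 𝔼 3) 0 := fun q hq => by
    rw [hℓ]; simp only; rw [hinner q hq]; ring
  have hne : qm ≠ qM := fun h => by
    have := hqm0; rw [h, hqM0] at this; norm_num at this
  have huniq : ∀ q, ¬ Surjective (mfderiv (𝓡 4) (𝓡 2) f q) → ((f q : 𝕊²) : 𝔼 3) 1 = 0 →
      q = qm ∨ q = qM := by
    intro q hq hq1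
    obtain ⟨-, h0 | h0⟩ := hf.apply_two_eq_zero_and_apply_zero_eq_of_round hC hq hq1
    · exact Or.inr (hf.eq_of_round_of_apply_zero_eq hC hq hqM hq1 hqM1 (by rw [h0, hqM0]))
    · exact Or.inl (hf.eq_of_round_of_apply_zero_eq hC hq hqm hq1 hqm1 (by rw [h0, hqm0]))
  refine ⟨qm, qM, hne, hqm, hqM, hqm0, hqM0, by rw [hℓq qm hqm2, hqm0], by rw [hℓq qM hqM2, hqM0],
    by rw [hinner qm hqm2]; exact lt_irrefl 0, by rw [hinner qM hqM2]; exact lt_irrefl 0,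
    fun G x hx hGx => ?_⟩
  obtain ⟨hcritG, hndG, hindG⟩ := morseData_congr_of_eventuallyEq (I := 𝓡 4) hGx
  by_cases hreg : Surjective (mfderiv (𝓡 4) (𝓡 2) f x)
  · -- a regular point of `f` off the sphere side is not critical
    have hfd : MDifferentiableAt (𝓡 4) (𝓡 2) f x := (hf.contMDiff x).mdifferentiableAt (by simp)
    have hℓd : MDifferentiableAt (𝓡 2) 𝓘(ℝ, ℝ) ℓ (f x) := (hℓs (f x)).mdifferentiableAt (by simp)
    have hnc : ¬ IsMCriticalPt (𝓡 4) (ℓ ∘ f) x := fun hc =>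
      hx (hcritv (f x) ((isMCriticalPt_comp_iff_of_surjective_mfderiv hfd hℓd hreg).1 hc))
    have hxm : x ≠ qm := fun h => hqm (h ▸ hreg)
    have hxM : x ≠ qM := fun h => hqM (h ▸ hreg)
    exact ⟨⟨fun hc => absurd (hcritG.1 hc) hnc, fun h => h.elim (fun h => absurd h hxm)
      fun h => absurd h hxM⟩, fun hc => absurd (hcritG.1 hc) hnc⟩
  · -- a round point: the Morse data of `ℓ ∘ f` transfer through the germ
    obtain ⟨hiff, hdata⟩ := hround x hreg
    have key : IsMCriticalPt (𝓡 4) G x ↔ x = qm ∨ x = qM := by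
      rw [hcritG, hiff]
      exact ⟨huniq x hreg, fun h => h.elim (fun h => h ▸ hqm1) fun h => h ▸ hqM1⟩
    refine ⟨key, fun hc => ?_⟩
    obtain ⟨hnd, hind⟩ := hdata (hiff.1 (hcritG.1 hc))
    exact ⟨hndG.2 hnd, by rw [hindG, hind]⟩

end Summit.SmoothPoincare4.SmoothPoincare4.Cruxes.RungOne.Sketch

end
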